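import Summits.CriticalPhenomena.PercolationContinuityZ3.Theorems.SahiMasterFamilyFInequalityFirstArgument
import Summits.CriticalPhenomena.PercolationContinuityZ3.Theorems.SahiMasterFamilyFInequalityJunta
import Summits.CriticalPhenomena.PercolationContinuityZ3.Theorems.SahiMasterFamilyFInequalityComparable
import Summits.CriticalPhenomena.PercolationContinuityZ3.Theorems.SahiMasterFamilyFCrossClosure

/-!
# `F(A,B;G) ≥ 0` for ALL increasing `A, B` whenever the third event is determined by at most THREE coordinates

Unit `prim-master-conj` (crux anchor stmt-CriticalPhenomena-4575, helper work), gen 22; memo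
`run/shared/lean/prim/prim-l12/prim-master-conj/POINTWISE.md` §23.  Assembles gen 21/22's kernel classes (`…FInequalityTwoCoordinates`,
`…FInequalityJunta`, `…FInequalityFirstArgument`, `…FInequalityComparable`) with prim-bnk-2's closure of the third argument (`…FCrossClosure`).

`F(A,B;G) := (1 + μG)·μ(A∩B∩G) − μG·μ(A∩B) − μ(A∩G)·μ(B∩G)` (product measure; conjectured `≥ 0` for increasing `A, B, G`).
A coordinate `e` is EXTREMAL for an increasing event `U` if `U ⊆ {e ∈ ω}` or `{e ∈ ω} ⊆ U`.  The argument ("strip extremal coordinates"):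
* `fIneq_nonneg_of_first_determinedBy_pair` — first member a `≤ 2`-junta ⟹ `F ≥ 0` for all increasing `B, G` (six shapes, gen 22's first-argument classes);
* `fIneq_nonneg_of_first_subset_coord_pair`, `fIneq_nonneg_of_coord_subset_first_pair` — first member with an extremal coordinate whose section is a
  `≤ 2`-junta ⟹ `F ≥ 0` for all `B, G` (closure of the first argument); `…third…` — the same for the third member (bnk-2's closure + gen 22's
  `fIneq_nonneg_of_determinedBy_pair`);
* `eq_maj_of_no_extremal` — an increasing event determined by `{a,b,c}` with NO extremal coordinate among `a, b, c` is the majority event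
  `maj = x_ax_b ∨ x_ax_c ∨ x_bx_c`;
* **`fIneq_nonneg_of_all_determinedBy_triple`** — `F(A,B;G) ≥ 0` for all increasing `A, B, G` determined by `{a,b,c}`: strip an extremal coordinate of
  `A`, `B` or `G` if there is one; otherwise `A = B = G = maj` and the diagonal case `fIneq_nonneg_of_eq` applies;
* **`fIneq_nonneg_of_determinedBy_triple`**, **`fIneq_nonneg_of_determinedBy_card_le_three`** — by the junta reduction (`fIneq_nonneg_of_determinedBy`):
  `F(A,B;G) ≥ 0` for ALL increasing `A, B` of `2^ι` whenever the increasing third event `G` is determined by at most three coordinates — ALL ≤3-JUNTAS;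
* `sahiE_three_ge_sq_minor_of_third_determinedBy_triple` — the D0-core consequence (`MD_3` unconditional when the `e`-free third member is a ≤3-junta).
HONEST FRAMING: elementary assembly; on paper `F ≥ 0` is known for every `≤ 6`-junta `G` (computer-assisted census); `F ≥ 0` in general remains OPEN. [this work]
-/

noncomputable section

open scoped Classical

namespace Summit.CriticalPhenomena.PercolationContinuityZ3.Theorems

open Finset Function
open Literature.Combinatorics.Sahi2008
open Literature.Probability.Percolation (DeterminedBy determinedBy_iff)
open Literature.Probability.Percolation.DecisionTree (ind)

namespace Pointwise

variable {ι : Type} [Fintype ι]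

local notation3 (prettyPrint := false) "μ⟦" p ", " X "⟧" => ex (bernoulliWeight p) (ind X)

/-! ### 1. First member on at most two coordinates -/

/-- `F(x_a ∩ x_b, B; G) ≥ 0` for all increasing `B, G`. [this work] -/
theorem fIneq_nonneg_of_first_inter_coords (p : ι → unitInterval) {a b : ι} (hab : a ≠ b) {B G : Set (Set ι)} (hB : IsUpperSet B)
    (hG : IsUpperSet G) :
    0 ≤ (1 + μ⟦p, G⟧) * μ⟦p, ({ω : Set ι | a ∈ ω} ∩ {ω : Set ι | b ∈ ω}) ∩ B ∩ G⟧
        - μ⟦p, G⟧ * μ⟦p, ({ω : Set ι | a ∈ ω} ∩ {ω : Set ι | b ∈ ω}) ∩ B⟧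
        - μ⟦p, ({ω : Set ι | a ∈ ω} ∩ {ω : Set ι | b ∈ ω}) ∩ G⟧ * μ⟦p, B ∩ G⟧ := by
  have h0 : secAt a false ({ω : Set ι | a ∈ ω} ∩ {ω : Set ι | b ∈ ω}) = ∅ := by
    rw [secAt_inter, SahiCombDisjunct.secAt_false_coord, Set.empty_inter]
  have h1 : secAt a true ({ω : Set ι | a ∈ ω} ∩ {ω : Set ι | b ∈ ω}) = {ω : Set ι | b ∈ ω} := by
    rw [secAt_inter, SahiCombDisjunct.secAt_true_coord, secAt_coord_of_ne hab, Set.univ_inter]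
  refine fIneq_nonneg_forall_of_first_subset_coord p a h0 (fun B' G' hB' hG' => ?_) hB hG
  rw [h1]; exact fIneq_nonneg_of_first_coordinate p b hB' hG'

/-- `F(x_a ∪ x_b, B; G) ≥ 0` for all increasing `B, G`. [this work] -/
theorem fIneq_nonneg_of_first_union_coords (p : ι → unitInterval) {a b : ι} (hab : a ≠ b) {B G : Set (Set ι)} (hB : IsUpperSet B)
    (hG : IsUpperSet G) :
    0 ≤ (1 + μ⟦p, G⟧) * μ⟦p, ({ω : Set ι | a ∈ ω} ∪ {ω : Set ι | b ∈ ω}) ∩ B ∩ G⟧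
        - μ⟦p, G⟧ * μ⟦p, ({ω : Set ι | a ∈ ω} ∪ {ω : Set ι | b ∈ ω}) ∩ B⟧
        - μ⟦p, ({ω : Set ι | a ∈ ω} ∪ {ω : Set ι | b ∈ ω}) ∩ G⟧ * μ⟦p, B ∩ G⟧ := by
  have h1 : secAt a true ({ω : Set ι | a ∈ ω} ∪ {ω : Set ι | b ∈ ω}) = Set.univ := by
    rw [SahiCombDisjunct.secAt_union, SahiCombDisjunct.secAt_true_coord, Set.univ_union]
  have h0 : secAt a false ({ω : Set ι | a ∈ ω} ∪ {ω : Set ι | b ∈ ω}) = {ω : Set ι | b ∈ ω} := by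
    rw [SahiCombDisjunct.secAt_union, SahiCombDisjunct.secAt_false_coord, secAt_coord_of_ne hab, Set.empty_union]
  refine fIneq_nonneg_forall_of_coord_mem_first p a h1 (fun B' G' hB' hG' => ?_) hB hG
  rw [h0]; exact fIneq_nonneg_of_first_coordinate p b hB' hG'

/-- **First member a `≤ 2`-junta ⟹ `F(A,B;G) ≥ 0` for all increasing `B, G`.** [this work] -/
theorem fIneq_nonneg_of_first_determinedBy_pair (p : ι → unitInterval) {A : Set (Set ι)} (hA : IsUpperSet A) {a b : ι}
    (hAd : DeterminedBy A ({a, b} : Set ι)) {B G : Set (Set ι)} (hB : IsUpperSet B) (hG : IsUpperSet G) :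
    0 ≤ (1 + μ⟦p, G⟧) * μ⟦p, A ∩ B ∩ G⟧ - μ⟦p, G⟧ * μ⟦p, A ∩ B⟧ - μ⟦p, A ∩ G⟧ * μ⟦p, B ∩ G⟧ := by
  rcases upperSet_determinedBy_pair_cases hA hAd with h | h | h | h | h | h
  · rw [h, fIneq_first_empty]
  · rw [h]; exact fIneq_nonneg_of_first_univ p hB hG
  · rw [h]; exact fIneq_nonneg_of_first_coordinate p a hB hG
  · rw [h]; exact fIneq_nonneg_of_first_coordinate p b hB hG
  · by_cases hab : a = b
    · subst hab; rw [Set.inter_self] at h; rw [h]; exact fIneq_nonneg_of_first_coordinate p a hB hG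
    · rw [h]; exact fIneq_nonneg_of_first_inter_coords p hab hB hG
  · by_cases hab : a = b
    · subst hab; rw [Set.union_self] at h; rw [h]; exact fIneq_nonneg_of_first_coordinate p a hB hG
    · rw [h]; exact fIneq_nonneg_of_first_union_coords p hab hB hG

/-! ### 2. Stripping an extremal coordinate -/

/-- First member below a coordinate (`A ⊆ x_e`) whose `1`-section is a `≤ 2`-junta ⟹ `F ≥ 0` for all increasing `B, G`. [this work] -/
theorem fIneq_nonneg_of_first_subset_coord_pair (p : ι → unitInterval) (e : ι) {a b : ι} {A : Set (Set ι)} (hA : IsUpperSet A)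
    (he : A ⊆ {ω : Set ι | e ∈ ω}) (hA1d : DeterminedBy (secAt e true A) ({a, b} : Set ι)) {B G : Set (Set ι)} (hB : IsUpperSet B)
    (hG : IsUpperSet G) :
    0 ≤ (1 + μ⟦p, G⟧) * μ⟦p, A ∩ B ∩ G⟧ - μ⟦p, G⟧ * μ⟦p, A ∩ B⟧ - μ⟦p, A ∩ G⟧ * μ⟦p, B ∩ G⟧ :=
  fIneq_nonneg_forall_of_first_subset_coord p e (SahiFInduction.secAt_false_eq_empty_of_subset_coord he)
    (fun _ _ hB' hG' => fIneq_nonneg_of_first_determinedBy_pair p (isUpperSet_secAt e true hA) hA1d hB' hG') hB hG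

/-- First member above a coordinate (`x_e ⊆ A`) whose `0`-section is a `≤ 2`-junta ⟹ `F ≥ 0` for all increasing `B, G`. [this work] -/
theorem fIneq_nonneg_of_coord_subset_first_pair (p : ι → unitInterval) (e : ι) {a b : ι} {A : Set (Set ι)} (hA : IsUpperSet A)
    (he : {ω : Set ι | e ∈ ω} ⊆ A) (hA0d : DeterminedBy (secAt e false A) ({a, b} : Set ι)) {B G : Set (Set ι)} (hB : IsUpperSet B)
    (hG : IsUpperSet G) :
    0 ≤ (1 + μ⟦p, G⟧) * μ⟦p, A ∩ B ∩ G⟧ - μ⟦p, G⟧ * μ⟦p, A ∩ B⟧ - μ⟦p, A ∩ G⟧ * μ⟦p, B ∩ G⟧ :=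
  fIneq_nonneg_forall_of_coord_mem_first p e (SahiFInduction.secAt_true_eq_univ_of_coord_subset he)
    (fun _ _ hB' hG' => fIneq_nonneg_of_first_determinedBy_pair p (isUpperSet_secAt e false hA) hA0d hB' hG') hB hG

/-- Third member below a coordinate (`G ⊆ x_e`) whose `1`-section is a `≤ 2`-junta ⟹ `F ≥ 0` for all increasing `A, B` (bnk-2's AND-closure +
gen 22's `fIneq_nonneg_of_determinedBy_pair`). [this work] -/
theorem fIneq_nonneg_of_third_subset_coord_pair (p : ι → unitInterval) (e : ι) {a b : ι} {G : Set (Set ι)} (hG : IsUpperSet G)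
    (he : G ⊆ {ω : Set ι | e ∈ ω}) (hG1d : DeterminedBy (secAt e true G) ({a, b} : Set ι)) {A B : Set (Set ι)} (hA : IsUpperSet A)
    (hB : IsUpperSet B) :
    0 ≤ (1 + μ⟦p, G⟧) * μ⟦p, A ∩ B ∩ G⟧ - μ⟦p, G⟧ * μ⟦p, A ∩ B⟧ - μ⟦p, A ∩ G⟧ * μ⟦p, B ∩ G⟧ :=
  SahiFInduction.F_nonneg_forall_of_third_subset_coord p e hG he
    (fun _ _ hA' hB' => fIneq_nonneg_of_determinedBy_pair p (isUpperSet_secAt e true hG) hG1d hA' hB') A B hA hB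

/-- Third member above a coordinate (`x_e ⊆ G`) whose `0`-section is a `≤ 2`-junta ⟹ `F ≥ 0` for all increasing `A, B` (bnk-2's OR-closure). [this work] -/
theorem fIneq_nonneg_of_coord_subset_third_pair (p : ι → unitInterval) (e : ι) {a b : ι} {G : Set (Set ι)} (hG : IsUpperSet G)
    (he : {ω : Set ι | e ∈ ω} ⊆ G) (hG0d : DeterminedBy (secAt e false G) ({a, b} : Set ι)) {A B : Set (Set ι)} (hA : IsUpperSet A)
    (hB : IsUpperSet B) :
    0 ≤ (1 + μ⟦p, G⟧) * μ⟦p, A ∩ B ∩ G⟧ - μ⟦p, G⟧ * μ⟦p, A ∩ B⟧ - μ⟦p, A ∩ G⟧ * μ⟦p, B ∩ G⟧ :=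
  SahiFInduction.F_nonneg_forall_of_coord_subset_third p e hG he
    (fun _ _ hA' hB' => fIneq_nonneg_of_determinedBy_pair p (isUpperSet_secAt e false hG) hG0d hA' hB') A B hA hB

/-! ### 3. No extremal coordinate on three coordinates: the majority event -/

omit [Fintype ι] in
/-- **An increasing event determined by `{a,b,c}` none of whose three coordinates is extremal is the majority event.** [this work] -/
theorem eq_maj_of_no_extremal {U : Set (Set ι)} (hU : IsUpperSet U) {a b c : ι} (hUd : DeterminedBy U ({a, b, c} : Set ι))
    (na : ¬ U ⊆ {ω : Set ι | a ∈ ω}) (nb : ¬ U ⊆ {ω : Set ι | b ∈ ω}) (nc : ¬ U ⊆ {ω : Set ι | c ∈ ω})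
    (sa : ¬ {ω : Set ι | a ∈ ω} ⊆ U) (sb : ¬ {ω : Set ι | b ∈ ω} ⊆ U) (sc : ¬ {ω : Set ι | c ∈ ω} ⊆ U) :
    U = ({ω : Set ι | a ∈ ω} ∩ {ω : Set ι | b ∈ ω}) ∪ ({ω : Set ι | a ∈ ω} ∩ {ω : Set ι | c ∈ ω})
          ∪ ({ω : Set ι | b ∈ ω} ∩ {ω : Set ι | c ∈ ω}) := by
  rw [determinedBy_iff] at hUd
  have key : ∀ ω : Set ι, ω ∈ U ↔ ω ∩ {a, b, c} ∈ U := fun ω =>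
    hUd ω (ω ∩ {a, b, c}) (by rw [Set.inter_assoc, Set.inter_self])
  -- no singleton pattern is in `U`
  have hsing : ∀ x : ι, ¬ {ω : Set ι | x ∈ ω} ⊆ U → ({x} : Set ι) ∉ U := fun x hx h =>
    hx fun ω hω => hU (Set.singleton_subset_iff.2 hω) h
  have ha1 := hsing a sa
  have hb1 := hsing b sb
  have hc1 := hsing c sc
  -- every 2-pattern is in `U`
  have hpair : ∀ x y z : ι, ({x, y, z} : Set ι) = {a, b, c} → ¬ U ⊆ {ω : Set ι | z ∈ ω} → ({x, y} : Set ι) ∈ U := by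
    intro x y z hxyz hz
    by_contra hxy
    apply hz
    intro ω hω
    by_contra hzω
    have hω' : ω ∩ {a, b, c} ∈ U := (key ω).1 hω
    have hsub : ω ∩ {a, b, c} ⊆ {x, y} := by
      intro t ht
      rw [← hxyz] at ht
      simp only [Set.mem_inter_iff, Set.mem_insert_iff, Set.mem_singleton_iff] at ht ⊢
      rcases ht with ⟨htω, rfl | rfl | rfl⟩
      · exact Or.inl rfl
      · exact Or.inr rfl
      · exact absurd htω hzω
    exact hxy (hU hsub hω')
  have hab : ({a, b} : Set ι) ∈ U := hpair a b c rfl nc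
  have hac : ({a, c} : Set ι) ∈ U := hpair a c b (by ext t; simp only [Set.mem_insert_iff, Set.mem_singleton_iff]; tauto) nb
  have hbc : ({b, c} : Set ι) ∈ U := hpair b c a (by ext t; simp only [Set.mem_insert_iff, Set.mem_singleton_iff]; tauto) na
  ext ω
  simp only [Set.mem_union, Set.mem_inter_iff, Set.mem_setOf_eq]
  constructor
  · intro hω
    have hω' : ω ∩ {a, b, c} ∈ U := (key ω).1 hω
    by_contra hne
    -- at most one of `a, b, c` lies in `ω`: the trace is inside a singleton or empty
    by_cases hωa : a ∈ ω
    · have hωb : b ∉ ω := fun h => hne (Or.inl (Or.inl ⟨hωa, h⟩))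
      have hωc : c ∉ ω := fun h => hne (Or.inl (Or.inr ⟨hωa, h⟩))
      have hsub : ω ∩ {a, b, c} ⊆ {a} := by
        intro t ht
        simp only [Set.mem_inter_iff, Set.mem_insert_iff, Set.mem_singleton_iff] at ht ⊢
        rcases ht with ⟨htω, rfl | rfl | rfl⟩
        · rfl
        · exact absurd htω hωb
        · exact absurd htω hωc
      exact ha1 (hU hsub hω')
    · by_cases hωb : b ∈ ω
      · have hωc : c ∉ ω := fun h => hne (Or.inr ⟨hωb, h⟩)
        have hsub : ω ∩ {a, b, c} ⊆ {b} := by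
          intro t ht
          simp only [Set.mem_inter_iff, Set.mem_insert_iff, Set.mem_singleton_iff] at ht ⊢
          rcases ht with ⟨htω, rfl | rfl | rfl⟩
          · exact absurd htω hωa
          · rfl
          · exact absurd htω hωc
        exact hb1 (hU hsub hω')
      · have hsub : ω ∩ {a, b, c} ⊆ {c} := by
          intro t ht
          simp only [Set.mem_inter_iff, Set.mem_insert_iff, Set.mem_singleton_iff] at ht ⊢
          rcases ht with ⟨htω, rfl | rfl | rfl⟩
          · exact absurd htω hωa
          · exact absurd htω hωb
          · rfl
        exact hc1 (hU hsub hω')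
  · rintro ((⟨h1, h2⟩ | ⟨h1, h2⟩) | ⟨h1, h2⟩)
    · exact hU (Set.insert_subset_iff.2 ⟨h1, Set.singleton_subset_iff.2 h2⟩) hab
    · exact hU (Set.insert_subset_iff.2 ⟨h1, Set.singleton_subset_iff.2 h2⟩) hac
    · exact hU (Set.insert_subset_iff.2 ⟨h1, Set.singleton_subset_iff.2 h2⟩) hbc

/-! ### 4. Every triple on three coordinates -/

omit [Fintype ι] in
/-- Sections of a `{a,b,c}`-determined event along `a` are determined by `{b, c}` (and cyclically). [folklore] -/
theorem determinedBy_secAt_of_triple {U : Set (Set ι)} {e x y : ι} (hUd : DeterminedBy U ({e, x, y} : Set ι)) (bb : Bool) :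
    DeterminedBy (secAt e bb U) ({x, y} : Set ι) := by
  have h : DeterminedBy U (↑({e, x, y} : Finset ι) : Set ι) := by
    simpa only [Finset.coe_insert, Finset.coe_singleton] using hUd
  have h2 := determinedBy_secAt e bb h
  refine h2.mono ?_
  intro t ht
  simp only [Finset.coe_erase, Finset.coe_insert, Finset.coe_singleton, Set.mem_sdiff, Set.mem_insert_iff,
    Set.mem_singleton_iff] at ht
  simp only [Set.mem_insert_iff, Set.mem_singleton_iff]
  tauto

/-- **`F(A,B;G) ≥ 0` for all increasing `A, B, G` determined by three coordinates `{a,b,c}`.**  Strip an extremal coordinate of `A`, `B` or `G` if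
there is one (sections 1–2); otherwise all three are the majority event and the diagonal case applies. [this work] -/
theorem fIneq_nonneg_of_all_determinedBy_triple (p : ι → unitInterval) {a b c : ι} {A B G : Set (Set ι)} (hA : IsUpperSet A)
    (hB : IsUpperSet B) (hG : IsUpperSet G) (hAd : DeterminedBy A ({a, b, c} : Set ι)) (hBd : DeterminedBy B ({a, b, c} : Set ι))
    (hGd : DeterminedBy G ({a, b, c} : Set ι)) :
    0 ≤ (1 + μ⟦p, G⟧) * μ⟦p, A ∩ B ∩ G⟧ - μ⟦p, G⟧ * μ⟦p, A ∩ B⟧ - μ⟦p, A ∩ G⟧ * μ⟦p, B ∩ G⟧ := by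
  -- the three determining-set orderings
  have e1 : ({b, a, c} : Set ι) = {a, b, c} := by ext t; simp only [Set.mem_insert_iff, Set.mem_singleton_iff]; tauto
  have e2 : ({c, a, b} : Set ι) = {a, b, c} := by ext t; simp only [Set.mem_insert_iff, Set.mem_singleton_iff]; tauto
  have hAb : DeterminedBy A ({b, a, c} : Set ι) := by rw [e1]; exact hAd
  have hAc : DeterminedBy A ({c, a, b} : Set ι) := by rw [e2]; exact hAd
  have hBb : DeterminedBy B ({b, a, c} : Set ι) := by rw [e1]; exact hBd
  have hBc : DeterminedBy B ({c, a, b} : Set ι) := by rw [e2]; exact hBd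
  have hGb : DeterminedBy G ({b, a, c} : Set ι) := by rw [e1]; exact hGd
  have hGc : DeterminedBy G ({c, a, b} : Set ι) := by rw [e2]; exact hGd
  -- symmetric form of the goal (for the `B`-cases)
  have hsymm : ∀ {A' B' : Set (Set ι)},
      0 ≤ (1 + μ⟦p, G⟧) * μ⟦p, B' ∩ A' ∩ G⟧ - μ⟦p, G⟧ * μ⟦p, B' ∩ A'⟧ - μ⟦p, B' ∩ G⟧ * μ⟦p, A' ∩ G⟧ →
      0 ≤ (1 + μ⟦p, G⟧) * μ⟦p, A' ∩ B' ∩ G⟧ - μ⟦p, G⟧ * μ⟦p, A' ∩ B'⟧ - μ⟦p, A' ∩ G⟧ * μ⟦p, B' ∩ G⟧ := by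
    intro A' B' h; rw [fIneq_comm]; exact h
  -- extremal coordinates of `A`
  by_cases a1 : A ⊆ {ω : Set ι | a ∈ ω}
  · exact fIneq_nonneg_of_first_subset_coord_pair p a hA a1 (determinedBy_secAt_of_triple hAd true) hB hG
  by_cases a2 : A ⊆ {ω : Set ι | b ∈ ω}
  · exact fIneq_nonneg_of_first_subset_coord_pair p b hA a2 (determinedBy_secAt_of_triple hAb true) hB hG
  by_cases a3 : A ⊆ {ω : Set ι | c ∈ ω}
  · exact fIneq_nonneg_of_first_subset_coord_pair p c hA a3 (determinedBy_secAt_of_triple hAc true) hB hG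
  by_cases a4 : {ω : Set ι | a ∈ ω} ⊆ A
  · exact fIneq_nonneg_of_coord_subset_first_pair p a hA a4 (determinedBy_secAt_of_triple hAd false) hB hG
  by_cases a5 : {ω : Set ι | b ∈ ω} ⊆ A
  · exact fIneq_nonneg_of_coord_subset_first_pair p b hA a5 (determinedBy_secAt_of_triple hAb false) hB hG
  by_cases a6 : {ω : Set ι | c ∈ ω} ⊆ A
  · exact fIneq_nonneg_of_coord_subset_first_pair p c hA a6 (determinedBy_secAt_of_triple hAc false) hB hG
  -- extremal coordinates of `B`
  by_cases b1 : B ⊆ {ω : Set ι | a ∈ ω}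
  · exact hsymm (fIneq_nonneg_of_first_subset_coord_pair p a hB b1 (determinedBy_secAt_of_triple hBd true) hA hG)
  by_cases b2 : B ⊆ {ω : Set ι | b ∈ ω}
  · exact hsymm (fIneq_nonneg_of_first_subset_coord_pair p b hB b2 (determinedBy_secAt_of_triple hBb true) hA hG)
  by_cases b3 : B ⊆ {ω : Set ι | c ∈ ω}
  · exact hsymm (fIneq_nonneg_of_first_subset_coord_pair p c hB b3 (determinedBy_secAt_of_triple hBc true) hA hG)
  by_cases b4 : {ω : Set ι | a ∈ ω} ⊆ B
  · exact hsymm (fIneq_nonneg_of_coord_subset_first_pair p a hB b4 (determinedBy_secAt_of_triple hBd false) hA hG)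
  by_cases b5 : {ω : Set ι | b ∈ ω} ⊆ B
  · exact hsymm (fIneq_nonneg_of_coord_subset_first_pair p b hB b5 (determinedBy_secAt_of_triple hBb false) hA hG)
  by_cases b6 : {ω : Set ι | c ∈ ω} ⊆ B
  · exact hsymm (fIneq_nonneg_of_coord_subset_first_pair p c hB b6 (determinedBy_secAt_of_triple hBc false) hA hG)
  -- extremal coordinates of `G`
  by_cases g1 : G ⊆ {ω : Set ι | a ∈ ω}
  · exact fIneq_nonneg_of_third_subset_coord_pair p a hG g1 (determinedBy_secAt_of_triple hGd true) hA hB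
  by_cases g2 : G ⊆ {ω : Set ι | b ∈ ω}
  · exact fIneq_nonneg_of_third_subset_coord_pair p b hG g2 (determinedBy_secAt_of_triple hGb true) hA hB
  by_cases g3 : G ⊆ {ω : Set ι | c ∈ ω}
  · exact fIneq_nonneg_of_third_subset_coord_pair p c hG g3 (determinedBy_secAt_of_triple hGc true) hA hB
  by_cases g4 : {ω : Set ι | a ∈ ω} ⊆ G
  · exact fIneq_nonneg_of_coord_subset_third_pair p a hG g4 (determinedBy_secAt_of_triple hGd false) hA hB
  by_cases g5 : {ω : Set ι | b ∈ ω} ⊆ G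
  · exact fIneq_nonneg_of_coord_subset_third_pair p b hG g5 (determinedBy_secAt_of_triple hGb false) hA hB
  by_cases g6 : {ω : Set ι | c ∈ ω} ⊆ G
  · exact fIneq_nonneg_of_coord_subset_third_pair p c hG g6 (determinedBy_secAt_of_triple hGc false) hA hB
  -- no extremal coordinate anywhere: `A = B = G = maj`
  have eA := eq_maj_of_no_extremal hA hAd a1 a2 a3 a4 a5 a6
  have eB := eq_maj_of_no_extremal hB hBd b1 b2 b3 b4 b5 b6
  rw [eA, eB]
  exact fIneq_nonneg_of_eq p (eA ▸ hA) hG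

/-! ### 5. All `≤ 3`-juntas as third event -/

/-- **`F(A,B;G) ≥ 0` for ALL increasing `A, B` whenever the increasing third event `G` is determined by three coordinates `{a,b,c}`**
(junta reduction `fIneq_nonneg_of_determinedBy` + the previous theorem). [this work] -/
theorem fIneq_nonneg_of_determinedBy_triple (p : ι → unitInterval) {G : Set (Set ι)} (hG : IsUpperSet G) {a b c : ι}
    (hGd : DeterminedBy G ({a, b, c} : Set ι)) {A B : Set (Set ι)} (hA : IsUpperSet A) (hB : IsUpperSet B) :
    0 ≤ (1 + μ⟦p, G⟧) * μ⟦p, A ∩ B ∩ G⟧ - μ⟦p, G⟧ * μ⟦p, A ∩ B⟧ - μ⟦p, A ∩ G⟧ * μ⟦p, B ∩ G⟧ := by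
  have hS : (↑({a, b, c} : Finset ι) : Set ι) = {a, b, c} := by
    simp only [Finset.coe_insert, Finset.coe_singleton]
  refine fIneq_nonneg_of_determinedBy p ({a, b, c} : Finset ι) (by rw [hS]; exact hGd) (fun A' B' hA' hB' hA'd hB'd => ?_) hA hB
  rw [hS] at hA'd hB'd
  exact fIneq_nonneg_of_all_determinedBy_triple p hA' hB' hG hA'd hB'd hGd

/-- Finset form: `G` increasing and determined by a nonempty finset with at most three elements. [this work] -/
theorem fIneq_nonneg_of_determinedBy_card_le_three (p : ι → unitInterval) {G : Set (Set ι)} (hG : IsUpperSet G) {S : Finset ι}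
    (hS : S.card ≤ 3) (hSne : S.Nonempty) (hGd : DeterminedBy G (↑S : Set ι)) {A B : Set (Set ι)} (hA : IsUpperSet A)
    (hB : IsUpperSet B) :
    0 ≤ (1 + μ⟦p, G⟧) * μ⟦p, A ∩ B ∩ G⟧ - μ⟦p, G⟧ * μ⟦p, A ∩ B⟧ - μ⟦p, A ∩ G⟧ * μ⟦p, B ∩ G⟧ := by
  obtain ⟨a, ha⟩ := hSne
  -- `S ⊆ {a, b, c}` for some `b, c`
  have hex : ∃ b c : ι, (↑S : Set ι) ⊆ {a, b, c} := by
    have hS' : (S.erase a).card ≤ 2 := by rw [Finset.card_erase_of_mem ha]; omega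
    by_cases h0 : (S.erase a).card = 0
    · refine ⟨a, a, fun x hx => ?_⟩
      have : x ∈ S.erase a ∨ x = a := by
        by_cases hxa : x = a
        · exact Or.inr hxa
        · exact Or.inl (Finset.mem_erase.2 ⟨hxa, Finset.mem_coe.1 hx⟩)
      rcases this with h | h
      · rw [Finset.card_eq_zero.1 h0] at h; exact absurd h (Finset.notMem_empty x)
      · simp [h]
    by_cases h1 : (S.erase a).card = 1
    · obtain ⟨b, hb⟩ := Finset.card_eq_one.1 h1
      refine ⟨b, b, fun x hx => ?_⟩
      by_cases hxa : x = a
      · simp [hxa]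
      · have : x ∈ S.erase a := Finset.mem_erase.2 ⟨hxa, Finset.mem_coe.1 hx⟩
        rw [hb] at this; simp [Finset.mem_singleton.1 this]
    · have h2 : (S.erase a).card = 2 := by omega
      obtain ⟨b, c, -, hbc⟩ := Finset.card_eq_two.1 h2
      refine ⟨b, c, fun x hx => ?_⟩
      by_cases hxa : x = a
      · simp [hxa]
      · have : x ∈ S.erase a := Finset.mem_erase.2 ⟨hxa, Finset.mem_coe.1 hx⟩
        rw [hbc] at this
        simp only [Finset.mem_insert, Finset.mem_singleton] at this
        simp only [Set.mem_insert_iff, Set.mem_singleton_iff]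
        tauto
  obtain ⟨b, c, hbc⟩ := hex
  exact fIneq_nonneg_of_determinedBy_triple p hG (hGd.mono hbc) hA hB

/-! ### 6. The D0-core consequence -/

/-- **MD_3 on the D0 core when the third member is determined by at most three coordinates** (hypotheses of
`sahiE_three_ge_sq_minor_of_F_nonneg`; `G = U_2^{e←0}` determined by `{a,b,c}`). [this work] -/
theorem sahiE_three_ge_sq_minor_of_third_determinedBy_triple (p : ι → unitInterval) (e : ι) {a b c : ι} (U : Fin 3 → Set (Set ι))
    (hU : ∀ j, IsUpperSet (U j)) (hG : secAt e true (U 2) = secAt e false (U 2))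
    (hXG : secAt e false (U 0) ⊆ secAt e false (U 2)) (hYG : secAt e false (U 1) ⊆ secAt e false (U 2))
    (hXY : ex (bernoulliWeight p) (ind (secAt e false (U 0) ∩ secAt e false (U 1)))
      = ex (bernoulliWeight p) (ind (secAt e false (U 0))) * ex (bernoulliWeight p) (ind (secAt e false (U 1))))
    (hGd : DeterminedBy (secAt e false (U 2)) ({a, b, c} : Set ι)) :
    (1 - (p e : ℝ)) ^ 2 * sahiE (bernoulliWeight p) 3 (fun j => ind (secAt e false (U j)))
        + (p e : ℝ) ^ 2 * sahiE (bernoulliWeight p) 3 (fun j => ind (secAt e true (U j)))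
      ≤ sahiE (bernoulliWeight p) 3 (fun j => ind (U j)) := by
  refine sahiE_three_ge_sq_minor_of_F_nonneg p e U hU hG hXG hYG hXY ?_
  exact fIneq_nonneg_of_determinedBy_triple p (isUpperSet_secAt e false (hU 2)) hGd
    (isUpperSet_secAt e true (hU 0)) (isUpperSet_secAt e true (hU 1))

end Pointwise

end Summit.CriticalPhenomena.PercolationContinuityZ3.Theorems
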